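import Literature.NumberTheory.Irrationality.FischlerSprangZudilin2019.EliminationProof
import Literature.NumberTheory.Transcendental.OddZetaSampling
import Literature.NumberTheory.Transcendental.RivoalSeriesAsymptotics
import HarnessLib

/-!
# Fischler–Sprang–Zudilin 2019, Theorem 2 — proved unconditionally

S. Fischler, J. Sprang, W. Zudilin, *Many odd zeta values are irrational*, Compos. Math. **155** (2019)
938–952 [FischlerSprangZudilin2019], Theorem 2: for every `ε > 0` and every sufficiently large odd `s`, at
least `2^{(1-ε) log s / log log s}` of `ζ(3), ζ(5), …, ζ(s)` are irrational. This file discharges the tree's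
named fact `manyOddZetaValuesIrrational` (`ManyOddZetaValues.lean`):
`theorem manyOddZetaValuesIrrational_holds : manyOddZetaValuesIrrational`.

## Architecture (the source's §6, followed step by step)

* `LinearForms.lean` (PROVED): the rational functions `R_n`, Lemma 1 (`r_{n,j} = ρ_{0,j} + ∑_{i odd} ρ_i
  ζ(i, j/D)`) and Lemma 2 (`d_{n+1}^{s+1} ρ_{0,j}, d_{n+1}^{s+1-i} ρ_i ∈ ℤ`).
* `EliminationProof.lean` (PROVED): Lemma 4 ⇒ integer weights `w_d`, `d ∣ D`, killing the exponents of a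
  prescribed set (`exists_int_weights`); `∑_{j=1}^{d} ζ(i, j/d) = d^i ζ(i)`; the divisor count of a primorial.
* here: `r̂_{n,d} := ∑_{j=1}^{d} r_{n,jD/d} = d · S(d)` where `S(d) = S 1 D s n d` is the tree's sample series
  of `R_n` over the lattice `(1/d)ℕ` (`OddZetaSampling.lean`, Sprang's route) — `sum_r_eq_mul_S`; the
  elimination `card_divisors_le_card_irrational_of_decay` (source: "`r̃_n = ∑_d w_d r̂_{n,d}` … is a linear
  form in `1` and the rational `ζ(i)` only, `A d_{n+1}^{s+1} r̃_n ∈ ℤ ∖ {0}` and `→ 0`"); the choice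
  `D = ∏_{p ≤ (1-2ε') log s} p` and the prime number theorem exactly as printed.

## The one deviation from the printed proof

The source feeds §6 with Lemma 3 (`lim r_{n,j}^{1/n} = g(x₀) < 3^{-(s+1)}` and `lim r_{n,j'}/r_{n,j} = 1`,
de Bruijn's saddle-point asymptotics), kept in the tree as the named fact `lemma3` (`Asymptotics.lean`;
`manyOddZetaValuesIrrational_of_lemma3` is the proof from it). §6 uses Lemma 3 only through
(i) `r̂_{n,d}/r̂_{n,D} → d/D`-type ratio limits and (ii) `d_{n+1}^{s+1} r_{n,1} → 0`. We obtain (i) from the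
tree's PROVED lattice-sum comparison `OddZetaSampling.eventually_abs_S_sub_S_le` (`S(d)/S(D) → 1` for
`d ∣ D`), and (ii) from a crude termwise bound (`r_le_crude`:
`r_{n,j} ≤ ((4n+1)(7n+1)(2n+1)^{s+1} + 2)·(8eD)^{3Dn}·4^{-n(s+1)}`, from `n!/∏_{ℓ≤n}(n+k+ℓ) ≤ (2n+1)4^{-n}`,
`1/n! ≤ eⁿ/nⁿ` and the vanishing of `R_n` at the first samples) together with `d_{n+1} ≤ e^{1.1(n+1)}`
(prime number theorem): the rate `e^{1.1(s+1)} (8eD)^{3D} 4^{-(s+1)}` is `< 1` as soon as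
`12·D(log D + 4) ≤ s` (`tendsto_lcm_pow_mul_S`), which the source's choice `D ≤ s^{1-ε'}` satisfies for
large `s`. The statement proved is exactly the printed Theorem 2 (same count, same `s` odd and large).

No new named facts; net effect: `manyOddZetaValuesIrrational` discharged.

## References
* [FischlerSprangZudilin2019] S. Fischler, J. Sprang, W. Zudilin, Many odd zeta values are irrational,
  Compos. Math. 155 (2019), 938–952, arXiv:1803.08905 — §§2–4, §6.
* [Sprang2018] J. Sprang, Infinitely many odd zeta values are irrational. By elementary means,
  arXiv:1802.09410 — the lattice sums `S(d)` (tree: `OddZetaSampling.lean`).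
-/

noncomputable section

open Finset Filter

namespace Literature.NumberTheory.Irrationality.FischlerSprangZudilin2019

open _root_.Topology
open Literature.NumberTheory.Transcendental (zetaValue)
open Literature.NumberTheory.Irrationality.DirichletLValues (hurwitzValue)
open Literature.NumberTheory.Transcendental.OddZeta (Rfun)
open Literature.NumberTheory.Transcendental.OddZetaSampling (S term)

/-! ### The `d`-lattice sums: `r̂_{n,d} = ∑_{j=1}^{d} r_{n,jD/d} = d · S(d)` -/

/-- `∑_{m < a b} f(m) = ∑_{ν<a} ∑_{j<b} f(ν b + j)`. [folklore] -/
private theorem sum_range_mul_blocks' {M : Type*} [AddCommMonoid M] (f : ℕ → M) (a b : ℕ) :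
    ∑ m ∈ range (a * b), f m = ∑ ν ∈ range a, ∑ j ∈ range b, f (ν * b + j) := by
  induction a with
  | zero => simp
  | succ a ih => rw [Nat.succ_mul, sum_range_add, ih, sum_range_succ]

/-- **`r̂_{n,d} = d·S(d)`**: for `d ∣ D`, `∑_{j=1}^{d} r_{n, jD/d} = ∑_{q ≥ 1} R_n(q/d) = d · S 1 D s n d`, the
tree's sample series of `OddZetaSampling.lean` over the lattice `(1/d)ℕ` (the samples `q/d ≤ 1 ≤ n` vanish).
[cite: FischlerSprangZudilin2019, §6 (definition of r̂_{n,d})] -/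
theorem sum_r_eq_mul_S {s D n d : ℕ} (hn : 1 ≤ n) (hD : 1 ≤ D) (hs : 3 * D + 1 ≤ s) (hd : d ∣ D) :
    ∑ j ∈ range d, r s D n ((j + 1) * (D / d)) = (d : ℝ) * S 1 D s n d := by
  have hD0 : 0 < D := hD
  have hd1 : 1 ≤ d := Nat.pos_of_dvd_of_pos hd hD0
  have hd0 : (d : ℝ) ≠ 0 := by exact_mod_cast (by omega : d ≠ 0)
  have hdD : d * (D / d) = D := by rw [mul_comm]; exact Nat.div_mul_cancel hd
  have hs' : (2 * 1 + 1) * D + 2 ≤ s + 1 := by omega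
  set F : ℕ → ℝ := fun q => Rfun 1 D s n (((q : ℝ) + 1) / d) with hF
  have hFsum : Summable F :=
    Literature.NumberTheory.Transcendental.OddZetaSampling.summable_term hD0 hd le_rfl hs'
  -- right-hand side: `d S(d) = ∑_q F q`
  have hRHS : (d : ℝ) * S 1 D s n d = ∑' q : ℕ, F q := by
    rw [Literature.NumberTheory.Transcendental.OddZetaSampling.S, mul_div_cancel₀ _ hd0]
    rfl
  -- the first `d` samples vanish
  have hzero : ∀ q ∈ range d, F q = 0 := by
    intro q hq
    have hq' : q + 1 ≤ d * 1 * n := by have := mem_range.1 hq; nlinarith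
    have := Literature.NumberTheory.Transcendental.OddZetaSampling.R_sample_eq_zero
      (r := 1) (s := s) (n := n) (m := q + 1) hd hD0 hq'
    rw [hF]
    push_cast at this ⊢
    exact this
  -- left-hand side, term by term, as subseries of `F`
  have hL : ∀ j ∈ range d, r s D n ((j + 1) * (D / d)) = ∑' m : ℕ, F ((m + 1) * d + j) := by
    intro j hj
    rw [r_eq_tsum_Rfun]
    refine tsum_congr fun m => ?_
    rw [hF]
    congr 1
    have : (((j + 1) * (D / d) : ℕ) : ℝ) / D = ((j : ℝ) + 1) / d := by
      have hD0' : (D : ℝ) ≠ 0 := by exact_mod_cast (by omega : D ≠ 0)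
      rw [div_eq_div_iff hD0' hd0]
      have : (((j + 1) * (D / d) : ℕ) : ℝ) * d = ((j : ℝ) + 1) * D := by
        rw [show ((j : ℝ) + 1) * D = (((j + 1) * (d * (D / d)) : ℕ) : ℝ) by rw [hdD]; push_cast; ring]
        push_cast
        ring
      exact this
    rw [this]
    push_cast
    field_simp
    ring
  rw [sum_congr rfl hL, hRHS]
  -- both sides as limits of the same partial sums
  have h1 : Tendsto (fun M : ℕ => ∑ j ∈ range d, ∑ m ∈ range M, F ((m + 1) * d + j)) atTop
      (𝓝 (∑ j ∈ range d, ∑' m : ℕ, F ((m + 1) * d + j))) := by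
    refine tendsto_finsetSum _ fun j hj => ?_
    have hinj : Function.Injective (fun m : ℕ => (m + 1) * d + j) := by
      intro a b hab
      have hj' := mem_range.1 hj
      have : (a + 1) * d = (b + 1) * d := by simpa using hab
      have := Nat.eq_of_mul_eq_mul_right (by omega) this
      omega
    exact (hFsum.comp_injective hinj).hasSum.tendsto_sum_nat
  have h2 : Tendsto (fun M : ℕ => ∑ q ∈ range ((M + 1) * d), F q) atTop (𝓝 (∑' q : ℕ, F q)) := by
    refine hFsum.hasSum.tendsto_sum_nat.comp ?_
    exact (tendsto_add_atTop_nat 1).atTop_mul_const' hd1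
  have heq : ∀ M : ℕ, ∑ j ∈ range d, ∑ m ∈ range M, F ((m + 1) * d + j) =
      ∑ q ∈ range ((M + 1) * d), F q := by
    intro M
    rw [show (M + 1) * d = 1 * d + M * d by ring, sum_range_add, one_mul, sum_eq_zero hzero, zero_add,
      sum_range_mul_blocks', sum_comm]
    refine sum_congr rfl fun m _ => sum_congr rfl fun j _ => ?_
    congr 1
    ring
  simp_rw [heq] at h1
  exact tendsto_nhds_unique h1 h2

/-! ### The crude decay bound for `r_{n,j}` -/

/-- `R_n(m + 1 + j/D) = 0` for `m + 2 ≤ n` (a zero of the numerator). [cite: FischlerSprangZudilin2019, §4 proof of Lemma 3] -/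
theorem R_shift_eq_zero {s D n : ℕ} {j : ℕ} (hj : 1 ≤ j) (hjD : j ≤ D) {m : ℕ} (hm : m + 2 ≤ n) :
    R s D n ((m : ℚ) + 1 + (j : ℚ) / D) = 0 := by
  have hD0 : (0 : ℚ) < D := by exact_mod_cast (hj.trans hjD)
  rw [R]
  have hzero : ∏ j' ∈ range (3 * D * n + 1), ((m : ℚ) + 1 + (j : ℚ) / D - n + (j' : ℚ) / D) = 0 := by
    have hidx : j ≤ D * (n - m - 1) := hjD.trans (Nat.le_mul_of_pos_right _ (by omega))
    refine prod_eq_zero (i := D * (n - m - 1) - j) (mem_range.2 ?_) ?_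
    · have h1 : D * (n - m - 1) ≤ D * n := Nat.mul_le_mul_left _ (by omega)
      have h2 : D * n ≤ 3 * D * n := by nlinarith
      generalize D * (n - m - 1) = A at *
      generalize 3 * D * n = B at *
      omega
    · have hc : ((n - m - 1 : ℕ) : ℚ) = (n : ℚ) - m - 1 := by
        rw [Nat.sub_sub, Nat.cast_sub (by omega : m + 1 ≤ n)]
        push_cast
        ring
      rw [Nat.cast_sub hidx, Nat.cast_mul, hc]
      field_simp
      ring
  rw [hzero, mul_zero, zero_div]

/-- **Termwise bound beyond the zeros**: for `k ≥ 0`, `1 ≤ j ≤ D`,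
`R_n(n + k + j/D) ≤ D^{3Dn} n!^{s+1-3D} (3n+k+1)^{3Dn+1} / (∏_{ℓ=0}^{n} (n+k+ℓ))^{s+1}`
(each numerator factor `k + (j+l)/D ≤ 3n + k + 1`, each denominator factor `≥ n+k+ℓ`). [folklore] -/
private theorem R_shift_le {s D n : ℕ} (hn : 1 ≤ n) {j : ℕ} (hj : 1 ≤ j) (hjD : j ≤ D) (k : ℕ) :
    R s D n ((n : ℚ) + k + (j : ℚ) / D) ≤
      (D : ℚ) ^ (3 * D * n) * (n.factorial : ℚ) ^ (s + 1 - 3 * D) * ((3 * n + k + 1 : ℕ) : ℚ) ^ (3 * D * n + 1) /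
        (∏ ℓ ∈ range (n + 1), ((n : ℚ) + k + ℓ)) ^ (s + 1) := by
  have hD0 : (0 : ℚ) < D := by exact_mod_cast (hj.trans hjD)
  have hjD' : (j : ℚ) / D ≤ 1 := by rw [div_le_one hD0]; exact_mod_cast hjD
  have hj0 : (0 : ℚ) < (j : ℚ) / D := by positivity
  rw [R]
  have hnum : ∏ j' ∈ range (3 * D * n + 1), ((n : ℚ) + k + (j : ℚ) / D - n + (j' : ℚ) / D) ≤
      ((3 * n + k + 1 : ℕ) : ℚ) ^ (3 * D * n + 1) := by
    rw [← card_range (3 * D * n + 1), ← prod_const, card_range]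
    refine prod_le_prod (fun j' _ => ?_) fun j' hj' => ?_
    · have : (0 : ℚ) ≤ (j' : ℚ) / D := by positivity
      linarith
    · have hj'' : (j' : ℚ) ≤ 3 * D * n := by exact_mod_cast (by have := mem_range.1 hj'; omega)
      have : (j' : ℚ) / D ≤ 3 * n := by rw [div_le_iff₀ hD0]; nlinarith
      push_cast
      linarith
  have hden : (∏ ℓ ∈ range (n + 1), ((n : ℚ) + k + ℓ)) ^ (s + 1) ≤
      (∏ ℓ ∈ range (n + 1), ((n : ℚ) + k + (j : ℚ) / D + ℓ)) ^ (s + 1) := by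
    refine pow_le_pow_left₀ (prod_nonneg fun ℓ _ => by positivity) (prod_le_prod (fun ℓ _ => by positivity)
      fun ℓ _ => by linarith) _
  have hn0 : (0 : ℚ) < n := by exact_mod_cast hn
  have hdenpos : 0 < (∏ ℓ ∈ range (n + 1), ((n : ℚ) + k + ℓ)) ^ (s + 1) :=
    pow_pos (prod_pos fun ℓ _ => by positivity) _
  calc (D : ℚ) ^ (3 * D * n) * (n.factorial : ℚ) ^ (s + 1 - 3 * D) *
        (∏ j' ∈ range (3 * D * n + 1), ((n : ℚ) + k + (j : ℚ) / D - n + (j' : ℚ) / D)) /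
        (∏ ℓ ∈ range (n + 1), ((n : ℚ) + k + (j : ℚ) / D + ℓ)) ^ (s + 1)
      ≤ (D : ℚ) ^ (3 * D * n) * (n.factorial : ℚ) ^ (s + 1 - 3 * D) *
        ((3 * n + k + 1 : ℕ) : ℚ) ^ (3 * D * n + 1) /
        (∏ ℓ ∈ range (n + 1), ((n : ℚ) + k + (j : ℚ) / D + ℓ)) ^ (s + 1) := by
        gcongr
    _ ≤ _ := div_le_div_of_nonneg_left (by positivity) hdenpos hden

/-- `n!/∏_{ℓ=0}^{n}(n+k+ℓ) ≤ (2n+1)/4^n` (`n ≥ 1`): the product is at least `∏_{ℓ=0}^{n}(n+ℓ) = n (2n)!/n!`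
and `4^n ≤ (2n+1) C(2n,n)` (Mathlib). [folklore] -/
private theorem factorial_div_prod_le {n : ℕ} (hn : 1 ≤ n) (k : ℕ) :
    (n.factorial : ℝ) / ∏ ℓ ∈ range (n + 1), ((n : ℝ) + k + ℓ) ≤ (2 * n + 1) / (4 : ℝ) ^ n := by
  have hn0 : (0 : ℝ) < n := by exact_mod_cast hn
  have hP0 : ∏ ℓ ∈ range (n + 1), ((n : ℝ) + ℓ) ≤ ∏ ℓ ∈ range (n + 1), ((n : ℝ) + k + ℓ) :=
    prod_le_prod (fun ℓ _ => by positivity) fun ℓ _ => by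
      have : (0 : ℝ) ≤ k := by positivity
      linarith
  have hP0pos : 0 < ∏ ℓ ∈ range (n + 1), ((n : ℝ) + ℓ) := prod_pos fun ℓ _ => by positivity
  -- `∏_{ℓ ≤ n} (n+ℓ) · n! = n · (2n)!`
  have hprod : (∏ ℓ ∈ range (n + 1), ((n : ℝ) + ℓ)) * n.factorial = n * (2 * n).factorial := by
    have h1 : ∏ ℓ ∈ range (n + 1), ((n : ℝ) + ℓ) = n * (((n + 1).ascFactorial n : ℕ) : ℝ) := by
      rw [prod_range_succ', Nat.ascFactorial_eq_prod_range]
      push_cast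
      rw [mul_comm]
      simp only [add_zero]
      congr 1
      exact prod_congr rfl fun ℓ _ => by ring
    have h2 : (n.factorial : ℝ) * (((n + 1).ascFactorial n : ℕ) : ℝ) = (((n + n).factorial : ℕ) : ℝ) := by
      exact_mod_cast Nat.factorial_mul_ascFactorial n n
    rw [h1, mul_assoc, mul_comm (((n + 1).ascFactorial n : ℕ) : ℝ), h2, two_mul]
  -- `n!² 4^n ≤ (2n+1) (2n)!`
  have hcb : (n.factorial : ℝ) * n.factorial * (4 : ℝ) ^ n ≤ (2 * n + 1) * (2 * n).factorial := by
    have h1 : 4 ^ n ≤ (2 * n + 1) * n.centralBinom := Nat.four_pow_le_two_mul_add_one_mul_central_binom n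
    have h2 : n.centralBinom * n.factorial * n.factorial = (2 * n).factorial := by
      have := Nat.choose_mul_factorial_mul_factorial (show n ≤ 2 * n by omega)
      rw [show 2 * n - n = n by omega] at this
      rw [Nat.centralBinom_eq_two_mul_choose]
      exact this
    have h3 : (4 : ℝ) ^ n ≤ (2 * n + 1) * (n.centralBinom : ℝ) := by exact_mod_cast h1
    have h4 : (n.centralBinom : ℝ) * n.factorial * n.factorial = (2 * n).factorial := by exact_mod_cast h2
    calc (n.factorial : ℝ) * n.factorial * (4 : ℝ) ^ n ≤ (n.factorial : ℝ) * n.factorial * ((2 * n + 1) * n.centralBinom) :=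
          mul_le_mul_of_nonneg_left h3 (by positivity)
      _ = (2 * n + 1) * ((n.centralBinom : ℝ) * n.factorial * n.factorial) := by ring
      _ = (2 * n + 1) * (2 * n).factorial := by rw [h4]
  calc (n.factorial : ℝ) / ∏ ℓ ∈ range (n + 1), ((n : ℝ) + k + ℓ)
      ≤ (n.factorial : ℝ) / ∏ ℓ ∈ range (n + 1), ((n : ℝ) + ℓ) :=
        div_le_div_of_nonneg_left (by positivity) hP0pos hP0
    _ ≤ (2 * n + 1) / (4 : ℝ) ^ n := by
        rw [div_le_div_iff₀ hP0pos (by positivity)]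
        have h5 : (n.factorial : ℝ) * (4 : ℝ) ^ n * n.factorial ≤ (2 * n + 1) * ((2 * n).factorial : ℝ) := by
          linarith [hcb]
        calc (n.factorial : ℝ) * (4 : ℝ) ^ n
            = (n.factorial : ℝ) * (4 : ℝ) ^ n * n.factorial / n.factorial := by
              field_simp
          _ ≤ (2 * n + 1) * ((2 * n).factorial : ℝ) / n.factorial :=
              div_le_div_of_nonneg_right h5 (by positivity)
          _ ≤ (2 * n + 1) * (n * ((2 * n).factorial : ℝ)) / n.factorial := by
              gcongr
              have : (1 : ℝ) ≤ n := by exact_mod_cast hn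
              nlinarith [show (0 : ℝ) < (2 * n).factorial by positivity]
          _ = (2 * n + 1) * ∏ ℓ ∈ range (n + 1), ((n : ℝ) + ℓ) := by
              rw [← hprod]
              field_simp

/-- `1/n! ≤ eⁿ/nⁿ` (from `nⁿ/n! ≤ eⁿ`). [folklore] -/
private theorem inv_factorial_le {n : ℕ} (hn : 1 ≤ n) :
    1 / (n.factorial : ℝ) ≤ Real.exp 1 ^ n / (n : ℝ) ^ n := by
  have hn0 : (0 : ℝ) < n := by exact_mod_cast hn
  have h := Real.pow_div_factorial_le_exp (n : ℝ) (Nat.cast_nonneg n) n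
  rw [← Real.exp_one_pow] at h
  rw [div_le_div_iff₀ (by positivity) (by positivity), one_mul]
  rw [div_le_iff₀ (by positivity)] at h
  linarith

/-- **The crude decay bound for the terms, `k ≤ 4n`**:
`B_k ≤ D^{3Dn} (7n+1) (8e)^{3Dn} ((2n+1)/4ⁿ)^{s+1}`. [folklore] -/
private theorem B_le_small {s D n : ℕ} (hn : 1 ≤ n) (h3D : 3 * D ≤ s) {k : ℕ} (hk : k ≤ 4 * n) :
    (D : ℝ) ^ (3 * D * n) * (n.factorial : ℝ) ^ (s + 1 - 3 * D) * ((3 * n + k + 1 : ℕ) : ℝ) ^ (3 * D * n + 1) /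
        (∏ ℓ ∈ range (n + 1), ((n : ℝ) + k + ℓ)) ^ (s + 1) ≤
      (D : ℝ) ^ (3 * D * n) * ((7 * n + 1 : ℕ) : ℝ) * (8 * Real.exp 1) ^ (3 * D * n) *
        ((2 * (n : ℝ) + 1) / (4 : ℝ) ^ n) ^ (s + 1) := by
  have hn0 : (0 : ℝ) < n := by exact_mod_cast hn
  set P := ∏ ℓ ∈ range (n + 1), ((n : ℝ) + k + ℓ) with hP
  have hPpos : 0 < P := prod_pos fun ℓ _ => by positivity
  have hf0 : (0 : ℝ) < n.factorial := by positivity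
  -- rewrite the left side as `D^{3Dn} (3n+k+1)^{3Dn+1} (n!/P)^{s+1} (1/n!)^{3D}`
  have e1 : (D : ℝ) ^ (3 * D * n) * (n.factorial : ℝ) ^ (s + 1 - 3 * D) *
      ((3 * n + k + 1 : ℕ) : ℝ) ^ (3 * D * n + 1) / P ^ (s + 1) =
      (D : ℝ) ^ (3 * D * n) * ((3 * n + k + 1 : ℕ) : ℝ) ^ (3 * D * n + 1) *
        ((n.factorial : ℝ) / P) ^ (s + 1) * (1 / (n.factorial : ℝ)) ^ (3 * D) := by
    rw [div_pow, div_pow, one_pow, show s + 1 = (s + 1 - 3 * D) + 3 * D by omega, pow_add,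
      show (s + 1 - 3 * D) + 3 * D - 3 * D = s + 1 - 3 * D by omega]
    field_simp
    rw [← pow_add]
  rw [e1]
  have e2 : ((n.factorial : ℝ) / P) ^ (s + 1) ≤ ((2 * (n : ℝ) + 1) / (4 : ℝ) ^ n) ^ (s + 1) :=
    pow_le_pow_left₀ (by positivity) (factorial_div_prod_le hn k) _
  have e3 : (1 / (n.factorial : ℝ)) ^ (3 * D) ≤ (Real.exp 1 ^ n / (n : ℝ) ^ n) ^ (3 * D) :=
    pow_le_pow_left₀ (by positivity) (inv_factorial_le hn) _
  have e4 : ((3 * n + k + 1 : ℕ) : ℝ) ^ (3 * D * n + 1) ≤ ((7 * n + 1 : ℕ) : ℝ) * (8 * (n : ℝ)) ^ (3 * D * n) := by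
    have h1 : ((3 * n + k + 1 : ℕ) : ℝ) ≤ ((7 * n + 1 : ℕ) : ℝ) := by exact_mod_cast (by omega)
    have h2 : ((7 * n + 1 : ℕ) : ℝ) ≤ 8 * (n : ℝ) := by
      have : (1 : ℝ) ≤ n := by exact_mod_cast hn
      push_cast; linarith
    calc ((3 * n + k + 1 : ℕ) : ℝ) ^ (3 * D * n + 1) ≤ ((7 * n + 1 : ℕ) : ℝ) ^ (3 * D * n + 1) :=
          pow_le_pow_left₀ (by positivity) h1 _
      _ = ((7 * n + 1 : ℕ) : ℝ) * ((7 * n + 1 : ℕ) : ℝ) ^ (3 * D * n) := by ring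
      _ ≤ ((7 * n + 1 : ℕ) : ℝ) * (8 * (n : ℝ)) ^ (3 * D * n) := by
          gcongr
  have e5 : (8 * (n : ℝ)) ^ (3 * D * n) * (Real.exp 1 ^ n / (n : ℝ) ^ n) ^ (3 * D) =
      (8 * Real.exp 1) ^ (3 * D * n) := by
    rw [div_pow, ← pow_mul, ← pow_mul, mul_pow, mul_pow, show n * (3 * D) = 3 * D * n by ring]
    field_simp
  calc (D : ℝ) ^ (3 * D * n) * ((3 * n + k + 1 : ℕ) : ℝ) ^ (3 * D * n + 1) *
        ((n.factorial : ℝ) / P) ^ (s + 1) * (1 / (n.factorial : ℝ)) ^ (3 * D)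
      ≤ (D : ℝ) ^ (3 * D * n) * (((7 * n + 1 : ℕ) : ℝ) * (8 * (n : ℝ)) ^ (3 * D * n)) *
        ((2 * (n : ℝ) + 1) / (4 : ℝ) ^ n) ^ (s + 1) * (Real.exp 1 ^ n / (n : ℝ) ^ n) ^ (3 * D) := by
        gcongr
    _ = (D : ℝ) ^ (3 * D * n) * ((7 * n + 1 : ℕ) : ℝ) *
        ((8 * (n : ℝ)) ^ (3 * D * n) * (Real.exp 1 ^ n / (n : ℝ) ^ n) ^ (3 * D)) *
        ((2 * (n : ℝ) + 1) / (4 : ℝ) ^ n) ^ (s + 1) := by ring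
    _ = _ := by rw [e5]

/-- **The crude decay bound for the terms, `k > 4n`**:
`B_k ≤ D^{3Dn} 2^{3Dn+1} n^{n(s+1-3D)} / k^{n(s+1-3D)+s}`. [folklore] -/
private theorem B_le_large {s D n : ℕ} (hn : 1 ≤ n) (h3D : 3 * D ≤ s) {k : ℕ} (hk : 4 * n + 1 ≤ k) :
    (D : ℝ) ^ (3 * D * n) * (n.factorial : ℝ) ^ (s + 1 - 3 * D) * ((3 * n + k + 1 : ℕ) : ℝ) ^ (3 * D * n + 1) /
        (∏ ℓ ∈ range (n + 1), ((n : ℝ) + k + ℓ)) ^ (s + 1) ≤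
      (D : ℝ) ^ (3 * D * n) * 2 ^ (3 * D * n + 1) * (n : ℝ) ^ (n * (s + 1 - 3 * D)) *
        (1 / (k : ℝ) ^ (n * (s + 1 - 3 * D) + s)) := by
  have hn0 : (0 : ℝ) < n := by exact_mod_cast hn
  have hk0 : (0 : ℝ) < k := by exact_mod_cast (by omega : 0 < k)
  set A := s + 1 - 3 * D with hA
  set P := ∏ ℓ ∈ range (n + 1), ((n : ℝ) + k + ℓ) with hP
  have hPpos : 0 < P := prod_pos fun ℓ _ => by positivity
  have hPge : (k : ℝ) ^ (n + 1) ≤ P := by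
    rw [hP, ← card_range (n + 1), ← prod_const, card_range]
    exact prod_le_prod (fun ℓ _ => hk0.le) fun ℓ _ => by
      have : (0 : ℝ) ≤ ℓ := by positivity
      linarith
  have hfac : (n.factorial : ℝ) ^ A ≤ (n : ℝ) ^ (n * A) := by
    rw [pow_mul]
    exact pow_le_pow_left₀ (by positivity) (by exact_mod_cast Nat.factorial_le_pow n) _
  have hnum : ((3 * n + k + 1 : ℕ) : ℝ) ^ (3 * D * n + 1) ≤ (2 * (k : ℝ)) ^ (3 * D * n + 1) :=
    pow_le_pow_left₀ (by positivity) (by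
      have : (4 * n + 1 : ℝ) ≤ k := by exact_mod_cast hk
      push_cast; linarith) _
  have hexp : (n + 1) * (s + 1) = (3 * D * n + 1) + (n * A + s) := by
    rw [hA]
    obtain ⟨e, he⟩ := Nat.exists_eq_add_of_le h3D
    rw [he, show 3 * D + e + 1 - 3 * D = e + 1 by omega]
    ring
  calc (D : ℝ) ^ (3 * D * n) * (n.factorial : ℝ) ^ A * ((3 * n + k + 1 : ℕ) : ℝ) ^ (3 * D * n + 1) / P ^ (s + 1)
      ≤ (D : ℝ) ^ (3 * D * n) * (n : ℝ) ^ (n * A) * (2 * (k : ℝ)) ^ (3 * D * n + 1) / ((k : ℝ) ^ (n + 1)) ^ (s + 1) := by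
        gcongr
    _ = (D : ℝ) ^ (3 * D * n) * 2 ^ (3 * D * n + 1) * (n : ℝ) ^ (n * A) *
        ((k : ℝ) ^ (3 * D * n + 1) / (k : ℝ) ^ ((n + 1) * (s + 1))) := by
        rw [mul_pow, ← pow_mul]
        ring
    _ = _ := by
        rw [hexp, pow_add (k : ℝ) (3 * D * n + 1) (n * A + s), one_div,
          div_mul_cancel_left₀ (pow_ne_zero _ hk0.ne')]

/-- **Sum of the term bounds**: for every `K`,
`∑_{k<K} B_k ≤ ((4n+1)(7n+1)(2n+1)^{s+1} + 2) (8eD)^{3Dn}/4^{n(s+1)}`. [folklore] -/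
private theorem sum_B_le {s D n : ℕ} (hn : 1 ≤ n) (hD : 1 ≤ D) (h3D : 3 * D ≤ s) (K : ℕ) :
    ∑ k ∈ range K, (D : ℝ) ^ (3 * D * n) * (n.factorial : ℝ) ^ (s + 1 - 3 * D) *
        ((3 * n + k + 1 : ℕ) : ℝ) ^ (3 * D * n + 1) / (∏ ℓ ∈ range (n + 1), ((n : ℝ) + k + ℓ)) ^ (s + 1) ≤
      ((((4 * n + 1) * (7 * n + 1) : ℕ) : ℝ) * (2 * (n : ℝ) + 1) ^ (s + 1) + 2) *
        (8 * Real.exp 1 * D) ^ (3 * D * n) / (4 : ℝ) ^ (n * (s + 1)) := by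
  have hn0 : (0 : ℝ) < n := by exact_mod_cast hn
  set B : ℕ → ℝ := fun k => (D : ℝ) ^ (3 * D * n) * (n.factorial : ℝ) ^ (s + 1 - 3 * D) *
    ((3 * n + k + 1 : ℕ) : ℝ) ^ (3 * D * n + 1) / (∏ ℓ ∈ range (n + 1), ((n : ℝ) + k + ℓ)) ^ (s + 1) with hB
  have hBnn : ∀ k, 0 ≤ B k := fun k => by
    rw [hB]
    exact div_nonneg (by positivity) (pow_nonneg (prod_nonneg fun ℓ _ => by positivity) _)
  change ∑ k ∈ range K, B k ≤ _
  -- split at `4n+1`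
  have hsplit : ∑ k ∈ range K, B k ≤ ∑ k ∈ range (4 * n + 1), B k + ∑ k ∈ Ico (4 * n + 1) K, B k := by
    rw [← sum_union]
    · refine sum_le_sum_of_subset_of_nonneg (fun k hk => ?_) fun k _ _ => hBnn k
      rw [mem_union, mem_range, mem_Ico]
      have := mem_range.1 hk
      omega
    · rw [disjoint_left]
      intro k hk hk'
      rw [mem_range] at hk
      rw [mem_Ico] at hk'
      omega
  -- part 1
  have h1 : ∑ k ∈ range (4 * n + 1), B k ≤ ((4 * n + 1 : ℕ) : ℝ) *
      ((D : ℝ) ^ (3 * D * n) * ((7 * n + 1 : ℕ) : ℝ) * (8 * Real.exp 1) ^ (3 * D * n) *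
        ((2 * (n : ℝ) + 1) / (4 : ℝ) ^ n) ^ (s + 1)) := by
    rw [← card_range (4 * n + 1), ← nsmul_eq_mul, ← sum_const, card_range]
    exact sum_le_sum fun k hk => by rw [hB]; exact B_le_small hn h3D (by have := mem_range.1 hk; omega)
  -- part 2
  have hA1 : 1 ≤ s + 1 - 3 * D := by omega
  have h2 : ∑ k ∈ Ico (4 * n + 1) K, B k ≤ 2 * (8 * (D : ℝ)) ^ (3 * D * n) / (4 : ℝ) ^ (n * (s + 1)) := by
    have hb : ∀ k ∈ Ico (4 * n + 1) K, B k ≤ (D : ℝ) ^ (3 * D * n) * 2 ^ (3 * D * n + 1) *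
        (n : ℝ) ^ (n * (s + 1 - 3 * D)) * (1 / (k : ℝ) ^ (n * (s + 1 - 3 * D) + s)) := by
      intro k hk
      rw [hB]
      exact B_le_large hn h3D (mem_Ico.1 hk).1
    refine (sum_le_sum hb).trans ?_
    rw [← mul_sum]
    have htail := Literature.NumberTheory.Transcendental.RivoalSeries.sum_Ico_inv_pow_le
      (M := 4 * n) (s := n * (s + 1 - 3 * D) + s) (by omega) (by nlinarith) K
    have h4n : (0 : ℝ) < ((4 * n : ℕ) : ℝ) := by exact_mod_cast (by omega : 0 < 4 * n)
    -- `n^{nA}/(4n)^{nA+s-1} ≤ 1/4^{nA}`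
    have hkey : (n : ℝ) ^ (n * (s + 1 - 3 * D)) * (1 / (((4 * n : ℕ) : ℝ)) ^ (n * (s + 1 - 3 * D) + s - 1)) ≤
        1 / (4 : ℝ) ^ (n * (s + 1 - 3 * D)) := by
      rw [show n * (s + 1 - 3 * D) + s - 1 = n * (s + 1 - 3 * D) + (s - 1) by omega, pow_add]
      push_cast
      rw [mul_pow, mul_one_div, div_le_div_iff₀ (by positivity) (by positivity), one_mul]
      have hn1 : (1 : ℝ) ≤ n := by exact_mod_cast hn
      have h1' : (1 : ℝ) ≤ (4 * (n : ℝ)) ^ (s - 1) := one_le_pow₀ (by linarith)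
      calc (n : ℝ) ^ (n * (s + 1 - 3 * D)) * (4 : ℝ) ^ (n * (s + 1 - 3 * D))
          = (4 : ℝ) ^ (n * (s + 1 - 3 * D)) * (n : ℝ) ^ (n * (s + 1 - 3 * D)) * 1 := by ring
        _ ≤ (4 : ℝ) ^ (n * (s + 1 - 3 * D)) * (n : ℝ) ^ (n * (s + 1 - 3 * D)) * (4 * (n : ℝ)) ^ (s - 1) := by
            gcongr
    have hpow4 : (4 : ℝ) ^ (n * (s + 1)) = (4 : ℝ) ^ (n * (s + 1 - 3 * D)) * (4 : ℝ) ^ (3 * D * n) := by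
      rw [← pow_add]; congr 1
      obtain ⟨e, he⟩ := Nat.exists_eq_add_of_le h3D
      rw [he, show 3 * D + e + 1 - 3 * D = e + 1 by omega]; ring
    calc (D : ℝ) ^ (3 * D * n) * 2 ^ (3 * D * n + 1) * (n : ℝ) ^ (n * (s + 1 - 3 * D)) *
          ∑ k ∈ Ico (4 * n + 1) K, 1 / (k : ℝ) ^ (n * (s + 1 - 3 * D) + s)
        ≤ (D : ℝ) ^ (3 * D * n) * 2 ^ (3 * D * n + 1) * ((n : ℝ) ^ (n * (s + 1 - 3 * D)) *
          (1 / (((4 * n : ℕ) : ℝ)) ^ (n * (s + 1 - 3 * D) + s - 1))) := by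
          rw [mul_assoc]
          exact mul_le_mul_of_nonneg_left (mul_le_mul_of_nonneg_left htail (by positivity)) (by positivity)
      _ ≤ (D : ℝ) ^ (3 * D * n) * 2 ^ (3 * D * n + 1) * (1 / (4 : ℝ) ^ (n * (s + 1 - 3 * D))) :=
          mul_le_mul_of_nonneg_left hkey (by positivity)
      _ = 2 * (8 * (D : ℝ)) ^ (3 * D * n) / (4 : ℝ) ^ (n * (s + 1)) := by
          rw [hpow4, show (8 : ℝ) = 2 * 4 by norm_num, mul_pow, mul_pow, pow_succ]
          field_simp
  -- combine
  refine hsplit.trans ((add_le_add h1 h2).trans ?_)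
  have he1 : (1 : ℝ) ≤ Real.exp 1 := by have := Real.add_one_le_exp (1 : ℝ); linarith
  have h8 : (8 * (D : ℝ)) ^ (3 * D * n) ≤ (8 * Real.exp 1 * D) ^ (3 * D * n) :=
    pow_le_pow_left₀ (by positivity) (by nlinarith [show (0 : ℝ) ≤ D from Nat.cast_nonneg D]) _
  have hD8 : (D : ℝ) ^ (3 * D * n) * (8 * Real.exp 1) ^ (3 * D * n) = (8 * Real.exp 1 * D) ^ (3 * D * n) := by
    rw [← mul_pow]; ring
  have hdiv : ((2 * (n : ℝ) + 1) / (4 : ℝ) ^ n) ^ (s + 1) = (2 * (n : ℝ) + 1) ^ (s + 1) / (4 : ℝ) ^ (n * (s + 1)) := by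
    rw [div_pow, ← pow_mul]
  rw [hdiv]
  have hpos : (0 : ℝ) < (4 : ℝ) ^ (n * (s + 1)) := by positivity
  calc ((4 * n + 1 : ℕ) : ℝ) * ((D : ℝ) ^ (3 * D * n) * ((7 * n + 1 : ℕ) : ℝ) * (8 * Real.exp 1) ^ (3 * D * n) *
          ((2 * (n : ℝ) + 1) ^ (s + 1) / (4 : ℝ) ^ (n * (s + 1)))) +
        2 * (8 * (D : ℝ)) ^ (3 * D * n) / (4 : ℝ) ^ (n * (s + 1))
      = ((((4 * n + 1) * (7 * n + 1) : ℕ) : ℝ) * (2 * (n : ℝ) + 1) ^ (s + 1) *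
          (8 * Real.exp 1 * D) ^ (3 * D * n) + 2 * (8 * (D : ℝ)) ^ (3 * D * n)) / (4 : ℝ) ^ (n * (s + 1)) := by
        rw [← hD8]; push_cast; field_simp
    _ ≤ _ := by
        rw [div_le_div_iff_of_pos_right hpos]
        push_cast
        linarith [h8]

/-- **Crude decay bound for the twisted linear forms**: for `n ≥ 1`, `1 ≤ j ≤ D`, `s ≥ 3D`,
`r_{n,j} ≤ ((4n+1)(7n+1)(2n+1)^{s+1} + 2) (8eD)^{3Dn} 4^{-n(s+1)}` (termwise bounds and the vanishing of
`R_n(m + j/D)` for `m < n`). This replaces, for the purposes of Theorem 2, the sharp value `g(x₀)` of Lemma 3.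
[cite: FischlerSprangZudilin2019, §4 Lemma 3 (upper bound part, crude form)] -/
theorem r_le_crude {s D n : ℕ} (hn : 1 ≤ n) (h3D : 3 * D ≤ s) {j : ℕ} (hj : 1 ≤ j) (hjD : j ≤ D) :
    r s D n j ≤ ((((4 * n + 1) * (7 * n + 1) : ℕ) : ℝ) * (2 * (n : ℝ) + 1) ^ (s + 1) + 2) *
        (8 * Real.exp 1 * D) ^ (3 * D * n) / (4 : ℝ) ^ (n * (s + 1)) := by
  have hD : 1 ≤ D := hj.trans hjD
  rw [r]
  refine Real.tsum_le_of_sum_range_le (fun m => by exact_mod_cast R_shift_nonneg hj hjD m) fun M => ?_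
  refine le_trans ?_ (sum_B_le hn hD h3D (M - (n - 1)))
  by_cases hM : n - 1 ≤ M
  · rw [← sum_range_add_sum_Ico _ hM, sum_Ico_eq_sum_range]
    have hz : ∑ m ∈ range (n - 1), (R s D n ((m : ℚ) + 1 + (j : ℚ) / D) : ℝ) = 0 :=
      sum_eq_zero fun m hm => by
        rw [R_shift_eq_zero hj hjD (by have := mem_range.1 hm; omega), Rat.cast_zero]
    rw [hz, zero_add]
    refine sum_le_sum fun k _ => ?_
    have hcast : (((n - 1 + k : ℕ) : ℚ) + 1 + (j : ℚ) / D) = (n : ℚ) + k + (j : ℚ) / D := by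
      rw [Nat.cast_add, Nat.cast_sub hn]; push_cast; ring
    rw [hcast]
    have := R_shift_le (s := s) hn hj hjD k
    have h' := (Rat.cast_le (K := ℝ)).2 this
    push_cast at h' ⊢
    exact h'
  · have hz : ∑ m ∈ range M, (R s D n ((m : ℚ) + 1 + (j : ℚ) / D) : ℝ) = 0 :=
      sum_eq_zero fun m hm => by
        rw [R_shift_eq_zero hj hjD (by have := mem_range.1 hm; omega), Rat.cast_zero]
    rw [hz]
    exact sum_nonneg fun k _ => div_nonneg (by positivity) (pow_nonneg (prod_nonneg fun ℓ _ => by positivity) _)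

/-- **The sample series is bounded likewise**: `S 1 D s n D ≤` the same bound (`D·S(D) = ∑_{j=1}^{D} r_{n,j}`).
[cite: FischlerSprangZudilin2019, §4 Lemma 3 (upper bound part, crude form)] -/
theorem S_le_crude {s D n : ℕ} (hn : 1 ≤ n) (hD : 1 ≤ D) (hs : 3 * D + 1 ≤ s) :
    S 1 D s n D ≤ ((((4 * n + 1) * (7 * n + 1) : ℕ) : ℝ) * (2 * (n : ℝ) + 1) ^ (s + 1) + 2) *
        (8 * Real.exp 1 * D) ^ (3 * D * n) / (4 : ℝ) ^ (n * (s + 1)) := by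
  have h := sum_r_eq_mul_S (s := s) (n := n) hn hD hs (dvd_refl D)
  have hD0 : (0 : ℝ) < D := by exact_mod_cast hD
  have hle : ∑ j ∈ range D, r s D n ((j + 1) * (D / D)) ≤ (D : ℝ) *
      (((((4 * n + 1) * (7 * n + 1) : ℕ) : ℝ) * (2 * (n : ℝ) + 1) ^ (s + 1) + 2) *
        (8 * Real.exp 1 * D) ^ (3 * D * n) / (4 : ℝ) ^ (n * (s + 1))) := by
    rw [← card_range D, ← nsmul_eq_mul, ← sum_const, card_range]
    refine sum_le_sum fun j hj => ?_
    rw [Nat.div_self hD, mul_one]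
    exact r_le_crude hn (by omega) (by omega) (by have := mem_range.1 hj; omega)
  rw [h] at hle
  exact le_of_mul_le_mul_left hle hD0

/-- **The cleared linear forms tend to `0`** (crude substitute for Lemma 3 combined with
`lim d_n^{1/n} = e`): if `D ≥ 2`, `3D + 1 ≤ s` and `12·D(log D + 4) ≤ s`, then
`d_{n+1}^{s+1} · S(D) → 0`, where `D·S(D) = ∑_{j=1}^{D} r_{n,j}` (FSZ use `d_{n+1}^{s+1} r_{n,1} → 0`, from
Lemma 3 and `g(x₀) e^{s+1} < (e/3)^{s+1}`; here the rate is `e^{1.1(s+1)} (8eD)^{3D} 4^{-(s+1)} < 1`).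
[cite: FischlerSprangZudilin2019, §6 (proof of Theorem 2)] -/
theorem tendsto_lcm_pow_mul_S {s D : ℕ} (hD : 2 ≤ D) (hs : 3 * D + 1 ≤ s)
    (hbig : 12 * ((D : ℝ) * (Real.log D + 4)) ≤ s) :
    Tendsto (fun n : ℕ => (Nat.lcmUpto (n + 1) : ℝ) ^ (s + 1) * S 1 D s n D) atTop (𝓝 0) := by
  have hD1 : 1 ≤ D := by omega
  have hD0 : (0 : ℝ) < D := by exact_mod_cast (by omega : 0 < D)
  have hDpos : 0 < D := by omega
  have hs' : (2 * 1 + 1) * D + 2 ≤ s + 1 := by omega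
  set ρ : ℝ := Real.exp (11 / 10 * ((s : ℝ) + 1)) * (8 * Real.exp 1 * D) ^ (3 * D) / (4 : ℝ) ^ (s + 1)
    with hρ
  have hρ0 : 0 < ρ := by positivity
  -- the rate is `< 1`
  have hρ1 : ρ < 1 := by
    have hlogD : 0 ≤ Real.log D := Real.log_nonneg (by exact_mod_cast hD1)
    have hX : 0 ≤ (D : ℝ) * Real.log D := mul_nonneg hD0.le hlogD
    have hl2 := Real.log_two_gt_d9
    have hl2' := Real.log_two_lt_d9
    have h8eD : (0 : ℝ) < 8 * Real.exp 1 * D := by positivity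
    rw [hρ, div_lt_one (by positivity), ← Real.exp_log (pow_pos h8eD (3 * D)), ← Real.exp_add,
      ← Real.exp_log (pow_pos (by norm_num : (0 : ℝ) < 4) (s + 1)), Real.exp_lt_exp, Real.log_pow,
      Real.log_pow, Real.log_mul (by positivity) hD0.ne', Real.log_mul (by norm_num) (Real.exp_pos 1).ne',
      Real.log_exp, show (4 : ℝ) = 2 ^ 2 by norm_num, Real.log_pow, show (8 : ℝ) = 2 ^ 3 by norm_num,
      Real.log_pow]
    push_cast
    have h1 : (0.6931471803 : ℝ) * ((s : ℝ) + 1) ≤ Real.log 2 * ((s : ℝ) + 1) :=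
      mul_le_mul_of_nonneg_right hl2.le (by positivity)
    have h2 : Real.log 2 * (D : ℝ) ≤ 0.6931471808 * D := mul_le_mul_of_nonneg_right hl2'.le hD0.le
    nlinarith [hX, h1, h2, hbig, hD0]
  -- `d_{n+1} ≤ e^{1.1 (n+1)}` eventually
  have hd : ∀ᶠ n : ℕ in atTop, (Nat.lcmUpto (n + 1) : ℝ) ≤ Real.exp (11 / 10 * ((n : ℝ) + 1)) := by
    have h := (Literature.NumberTheory.Transcendental.tendsto_log_lcmUpto_div.comp (tendsto_add_atTop_nat 1))
    filter_upwards [h.eventually_lt_const (show (1 : ℝ) < 11 / 10 by norm_num)] with n hn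
    simp only [Function.comp_apply] at hn
    have hpos : (0 : ℝ) < Nat.lcmUpto (n + 1) := by exact_mod_cast Nat.lcmUpto_pos _
    have hN : (0 : ℝ) < ((n + 1 : ℕ) : ℝ) := by positivity
    rw [div_lt_iff₀ hN] at hn
    push_cast at hn
    calc (Nat.lcmUpto (n + 1) : ℝ) = Real.exp (Real.log (Nat.lcmUpto (n + 1))) := (Real.exp_log hpos).symm
      _ ≤ Real.exp (11 / 10 * ((n : ℝ) + 1)) := Real.exp_le_exp.2 (by linarith)
  -- the polynomial factor
  have hpoly : ∀ n : ℕ, 1 ≤ n →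
      ((((4 * n + 1) * (7 * n + 1) : ℕ) : ℝ) * (2 * (n : ℝ) + 1) ^ (s + 1) + 2) ≤
        42 * (3 : ℝ) ^ (s + 1) * (n : ℝ) ^ (s + 3) := by
    intro n hn
    have hn1 : (1 : ℝ) ≤ n := by exact_mod_cast hn
    have h1 : (2 * (n : ℝ) + 1) ^ (s + 1) ≤ (3 * (n : ℝ)) ^ (s + 1) :=
      pow_le_pow_left₀ (by positivity) (by linarith) _
    have h2 : (1 : ℝ) ≤ (3 : ℝ) ^ (s + 1) := one_le_pow₀ (by norm_num)
    have h3 : (1 : ℝ) ≤ (n : ℝ) ^ (s + 1) := one_le_pow₀ hn1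
    have h4 : (n : ℝ) ^ (s + 3) = (n : ℝ) ^ (s + 1) * n * n := by ring
    rw [mul_pow] at h1
    push_cast
    rw [h4]
    nlinarith [h1, h2, h3, mul_nonneg (mul_nonneg (sub_nonneg.2 h2) (sub_nonneg.2 h3)) (mul_nonneg (by positivity : (0:ℝ) ≤ n) (by positivity : (0:ℝ) ≤ n)),
      pow_nonneg (by positivity : (0 : ℝ) ≤ 2 * n + 1) (s + 1), mul_nonneg (sub_nonneg.2 hn1) (by positivity : (0 : ℝ) ≤ n),
      mul_nonneg (mul_nonneg (sub_nonneg.2 hn1) (by positivity : (0 : ℝ) ≤ n)) (mul_nonneg (zero_le_one.trans h2) (zero_le_one.trans h3))]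
  -- the main bound, eventually
  have hmain : ∀ᶠ n : ℕ in atTop, (Nat.lcmUpto (n + 1) : ℝ) ^ (s + 1) * S 1 D s n D ≤
      (Real.exp (11 / 10 * ((s : ℝ) + 1)) * (42 * (3 : ℝ) ^ (s + 1))) * ((n : ℝ) ^ (s + 3) * ρ ^ n) := by
    filter_upwards [hd, eventually_ge_atTop 1] with n hdn hn
    have hS0 : 0 ≤ S 1 D s n D := Literature.NumberTheory.Transcendental.OddZetaSampling.S_nonneg hDpos (dvd_refl D)
    have hS := S_le_crude (s := s) hn hD1 hs
    have hdpow : (Nat.lcmUpto (n + 1) : ℝ) ^ (s + 1) ≤ Real.exp (11 / 10 * ((n : ℝ) + 1)) ^ (s + 1) :=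
      pow_le_pow_left₀ (Nat.cast_nonneg _) hdn _
    have hexp : Real.exp (11 / 10 * ((n : ℝ) + 1)) ^ (s + 1) =
        Real.exp (11 / 10 * ((s : ℝ) + 1)) * Real.exp (11 / 10 * ((s : ℝ) + 1)) ^ n := by
      rw [← Real.exp_nat_mul, ← Real.exp_nat_mul, ← Real.exp_add]
      congr 1; push_cast; ring
    have hrate : (8 * Real.exp 1 * D) ^ (3 * D * n) / (4 : ℝ) ^ (n * (s + 1)) =
        ((8 * Real.exp 1 * D) ^ (3 * D) / (4 : ℝ) ^ (s + 1)) ^ n := by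
      rw [div_pow, ← pow_mul, ← pow_mul, mul_comm n]
    calc (Nat.lcmUpto (n + 1) : ℝ) ^ (s + 1) * S 1 D s n D
        ≤ Real.exp (11 / 10 * ((n : ℝ) + 1)) ^ (s + 1) *
          (((((4 * n + 1) * (7 * n + 1) : ℕ) : ℝ) * (2 * (n : ℝ) + 1) ^ (s + 1) + 2) *
            (8 * Real.exp 1 * D) ^ (3 * D * n) / (4 : ℝ) ^ (n * (s + 1))) :=
          mul_le_mul hdpow hS hS0 (by positivity)
      _ ≤ Real.exp (11 / 10 * ((n : ℝ) + 1)) ^ (s + 1) *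
          ((42 * (3 : ℝ) ^ (s + 1) * (n : ℝ) ^ (s + 3)) *
            (8 * Real.exp 1 * D) ^ (3 * D * n) / (4 : ℝ) ^ (n * (s + 1))) := by
          gcongr
          exact hpoly n hn
      _ = (Real.exp (11 / 10 * ((s : ℝ) + 1)) * (42 * (3 : ℝ) ^ (s + 1))) * ((n : ℝ) ^ (s + 3) * ρ ^ n) := by
          rw [hexp, mul_div_assoc, hrate, hρ, div_pow, mul_pow, div_pow]
          ring
  have hlim : Tendsto (fun n : ℕ => (Real.exp (11 / 10 * ((s : ℝ) + 1)) * (42 * (3 : ℝ) ^ (s + 1))) *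
      ((n : ℝ) ^ (s + 3) * ρ ^ n)) atTop (𝓝 0) := by
    have := (tendsto_pow_const_mul_const_pow_of_abs_lt_one (s + 3)
      (show |ρ| < 1 by rwa [abs_of_pos hρ0])).const_mul
      (Real.exp (11 / 10 * ((s : ℝ) + 1)) * (42 * (3 : ℝ) ^ (s + 1)))
    rwa [mul_zero] at this
  refine squeeze_zero' ?_ hmain hlim
  exact Eventually.of_forall fun n => mul_nonneg (pow_nonneg (Nat.cast_nonneg _) _) (Literature.NumberTheory.Transcendental.OddZetaSampling.S_nonneg hDpos (dvd_refl D))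

/-! ### §6: the elimination argument, with the decay hypothesis in sampled form -/

/-- `k ∣ lcm(1, …, N)` in `ℤ` for `1 ≤ k ≤ N`. [folklore] -/
private theorem natCast_dvd_lcmUpto' {k N : ℕ} (h1 : 1 ≤ k) (hN : k ≤ N) :
    (k : ℤ) ∣ (Nat.lcmUpto N : ℤ) := by
  rw [Int.natCast_dvd_natCast, Nat.lcmUpto]
  exact Finset.dvd_lcm (Finset.mem_Icc.2 ⟨h1, hN⟩)

/-- **§6, the elimination argument, sampled form** (PROVED): let `s` be odd, `s ≥ 3D`, `D ≥ 2` even, and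
suppose `d_{n+1}^{s+1} S(D) → 0` where `D·S(D) = ∑_{j=1}^{D} r_{n,j}`. If `D` has at most
`#{odd i ∈ [3,s]} + 1` divisors, then at least `#{d : d ∣ D}` of `ζ(3), ζ(5), …, ζ(s)` are irrational.
Same argument as `card_divisors_le_card_irrational` (the source's §6), except that the asymptotic input
`r_{n,j'}/r_{n,1} → 1` of Lemma 3 is replaced by the lattice-sum ratios `S(d)/S(D) → 1` (`d ∣ D`) of the
tree's `OddZetaSampling.eventually_abs_S_sub_S_le` (Sprang's route), using `r̂_{n,d} = d·S(d)`.
[cite: FischlerSprangZudilin2019, §6 (proof of Theorem 2)] -/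
theorem card_divisors_le_card_irrational_of_decay {s D : ℕ} (hs : Odd s) (h3D : 3 * D ≤ s) (hD : 1 ≤ D)
    (hDeven : 2 ∣ D)
    (hdecay : Tendsto (fun n : ℕ => (Nat.lcmUpto (n + 1) : ℝ) ^ (s + 1) * S 1 D s n D) atTop (𝓝 0))
    (hroom : #D.divisors ≤ #((Icc 3 s).filter Odd) + 1) :
    #D.divisors ≤ Set.ncard {i : ℕ | Odd i ∧ 3 ≤ i ∧ i ≤ s ∧ Irrational (zetaValue i)} := by
  classical
  have hDpos : 0 < D := by omega
  -- `3D + 1 ≤ s`: `3D` is even and `s` is odd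
  have h3D1 : 3 * D + 1 ≤ s := by
    rcases Nat.eq_or_lt_of_le h3D with h | h
    · exfalso
      obtain ⟨e, he⟩ := hDeven
      obtain ⟨m, hm⟩ := hs
      omega
    · omega
  have hs' : (2 * 1 + 1) * D + 2 ≤ s + 1 := by omega
  set Sfin := (Icc 3 s).filter (fun i => Odd i ∧ Irrational (zetaValue i)) with hSfin
  have hset : {i : ℕ | Odd i ∧ 3 ≤ i ∧ i ≤ s ∧ Irrational (zetaValue i)} = ↑Sfin := by
    ext i
    simp only [Set.mem_setOf_eq, hSfin, coe_filter, mem_Icc]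
    tauto
  rw [hset, Set.ncard_coe_finset]
  by_contra hlt
  push Not at hlt
  set OddIcc := (Icc 3 s).filter Odd with hOddIcc
  have hSsub : Sfin ⊆ OddIcc := by
    intro i hi
    rw [hSfin, mem_filter] at hi
    exact mem_filter.2 ⟨hi.1, hi.2.1⟩
  have hδpos : 1 ≤ #D.divisors := card_pos.2 ⟨1, Nat.one_mem_divisors.2 (by omega)⟩
  -- the exponents `T ⊇ {irrational indices}`, `#T = δ - 1`
  obtain ⟨T, hST, hTO, hTcard⟩ := exists_subsuperset_card_eq hSsub (by omega : #Sfin ≤ #D.divisors - 1)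
    (by omega : #D.divisors - 1 ≤ #OddIcc)
  have hTmem : ∀ t ∈ T, 3 ≤ t ∧ t ≤ s ∧ Odd t := by
    intro t ht
    have := mem_filter.1 (hTO ht)
    exact ⟨(mem_Icc.1 this.1).1, (mem_Icc.1 this.1).2, this.2⟩
  have h1T : 1 ∉ T := fun h => by have := (hTmem 1 h).1; omega
  have hJcard : #D.divisors = #(insert 1 T) := by rw [card_insert_of_notMem h1T, hTcard]; omega
  have hJ1 : ∀ t ∈ insert 1 T, 1 ≤ t := fun t ht =>
    (mem_insert.1 ht).elim (fun h => h ▸ le_rfl) (fun h => le_trans (by norm_num) (hTmem t h).1)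
  obtain ⟨w, hwN, hwT⟩ := exists_int_weights D.divisors (insert 1 T) hJcard
    (fun x hx => Nat.pos_of_mem_divisors hx) (mem_insert_self 1 T) hJ1
  set N : ℤ := ∑ d ∈ D.divisors, w d * (d : ℤ) with hN
  set V : ℕ → ℤ := fun i => ∑ d ∈ D.divisors, w d * (d : ℤ) ^ i with hV
  have hVT : ∀ t ∈ T, V t = 0 := fun t ht =>
    hwT t (mem_insert_of_mem ht) (fun h => h1T (h ▸ ht))
  -- partial-fraction data for every `n ≥ 1`
  have hDn : ∀ n, Even (D * n) := fun n => (even_iff_two_dvd.2 hDeven).mul_right n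
  have hexists : ∀ n : ℕ, ∃ c : ℕ → ℕ → ℚ, 1 ≤ n → IsPF s D n c := by
    intro n
    by_cases hn : 1 ≤ n
    · obtain ⟨c, hc, -⟩ := exists_isPF s D n 0 h3D hn hD (fun k _ _ => dvd_zero _)
      exact ⟨c, fun _ => hc⟩
    · exact ⟨fun _ _ => 0, fun h => absurd h hn⟩
  choose c hc using hexists
  -- rational values of the non-eliminated zeta values
  have hrat : ∀ i : ℕ, ∃ q : ℚ, i ∈ OddIcc → i ∉ T → zetaValue i = q := by
    intro i
    by_cases h : i ∈ OddIcc ∧ i ∉ T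
    · have hnS : i ∉ Sfin := fun hS => h.2 (hST hS)
      have hnirr : ¬ Irrational (zetaValue i) := by
        intro hirr
        apply hnS
        have h1 := mem_filter.1 h.1
        exact mem_filter.2 ⟨h1.1, h1.2, hirr⟩
      unfold Irrational at hnirr
      push Not at hnirr
      obtain ⟨q, hq⟩ := hnirr
      exact ⟨q, fun _ _ => hq.symm⟩
    · exact ⟨0, fun h1 h2 => absurd ⟨h1, h2⟩ h⟩
  choose q hq using hrat
  set A : ℕ := ∏ i ∈ OddIcc \ T, (q i).den with hA
  have hApos : 0 < A := prod_pos fun i _ => (q i).den_pos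
  -- the combined linear forms
  set rtilde : ℕ → ℝ := fun n => ∑ d ∈ D.divisors, (w d : ℝ) *
    ∑ j ∈ range d, r s D n ((j + 1) * (D / d)) with hrtilde
  have hdiv_facts : ∀ d ∈ D.divisors, 1 ≤ d ∧ d * (D / d) = D ∧ 1 ≤ D / d := by
    intro d hd
    have h1 := Nat.pos_of_mem_divisors hd
    have h2 := Nat.div_mul_cancel (Nat.dvd_of_mem_divisors hd)
    refine ⟨h1, by rw [mul_comm]; exact h2, Nat.div_pos (Nat.divisor_le hd) h1⟩
  have hjrange : ∀ d ∈ D.divisors, ∀ j ∈ range d, 1 ≤ (j + 1) * (D / d) ∧ (j + 1) * (D / d) ≤ D := by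
    intro d hd j hj
    obtain ⟨h1, h2, h3⟩ := hdiv_facts d hd
    have hj' : j + 1 ≤ d := mem_range.1 hj
    refine ⟨Nat.le_mul_of_pos_right _ h3 |>.trans' (by omega), ?_⟩
    calc (j + 1) * (D / d) ≤ d * (D / d) := Nat.mul_le_mul_right _ hj'
      _ = D := h2
  -- Step 1: the arithmetic structure of `rtilde n`
  have hstruct : ∀ n : ℕ, 1 ≤ n → rtilde n =
      (∑ d ∈ D.divisors, (w d : ℝ) * ∑ j ∈ range d, (rhoZero s D n (c n) ((j + 1) * (D / d)) : ℝ)) +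
      ∑ i ∈ OddIcc \ T, (rho n (c n) i : ℝ) * (V i : ℝ) * (q i : ℝ) := by
    intro n hn
    have hr : ∀ d ∈ D.divisors, ∑ j ∈ range d, r s D n ((j + 1) * (D / d)) =
        ∑ j ∈ range d, (rhoZero s D n (c n) ((j + 1) * (D / d)) : ℝ) +
        ∑ i ∈ OddIcc, (rho n (c n) i : ℝ) * ((d : ℝ) ^ i * zetaValue i) := by
      intro d hd
      obtain ⟨hd1, hd2, hd3⟩ := hdiv_facts d hd
      have hterm : ∀ j ∈ range d, r s D n ((j + 1) * (D / d)) =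
          (rhoZero s D n (c n) ((j + 1) * (D / d)) : ℝ) +
          ∑ i ∈ OddIcc, (rho n (c n) i : ℝ) * hurwitzValue i (((j : ℝ) + 1) / d) := by
        intro j hj
        obtain ⟨hj1, hj2⟩ := hjrange d hd j hj
        rw [r_eq hs h3D hn (hDn n) (hc n hn) _ hj1 hj2]
        congr 1
        refine sum_congr rfl fun i _ => ?_
        congr 2
        have hD0 : (D : ℝ) ≠ 0 := by exact_mod_cast (by omega : D ≠ 0)
        have hd0 : (d : ℝ) ≠ 0 := by exact_mod_cast (by omega : d ≠ 0)
        have hDd : ((D / d : ℕ) : ℝ) = (D : ℝ) / d := by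
          rw [eq_div_iff hd0]; exact_mod_cast (by rw [mul_comm] at hd2; exact hd2.symm ▸ rfl)
        push_cast
        rw [hDd]
        field_simp
      rw [sum_congr rfl hterm, sum_add_distrib, sum_comm]
      congr 1
      refine sum_congr rfl fun i hi => ?_
      have hi2 : 2 ≤ i := by have := (mem_Icc.1 (mem_filter.1 hi).1).1; omega
      rw [← mul_sum, sum_hurwitzValue_eq d hd1 i hi2]
    have h1 : rtilde n = ∑ d ∈ D.divisors, (w d : ℝ) *
        (∑ j ∈ range d, (rhoZero s D n (c n) ((j + 1) * (D / d)) : ℝ) +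
          ∑ i ∈ OddIcc, (rho n (c n) i : ℝ) * ((d : ℝ) ^ i * zetaValue i)) := by
      rw [hrtilde]
      exact sum_congr rfl fun d hd => by rw [hr d hd]
    rw [h1]
    simp_rw [mul_add, sum_add_distrib]
    congr 1
    -- exchange the sums and split `OddIcc = T ∪ (OddIcc ∖ T)`
    have h2 : ∑ d ∈ D.divisors, (w d : ℝ) * ∑ i ∈ OddIcc, (rho n (c n) i : ℝ) * ((d : ℝ) ^ i * zetaValue i) =
        ∑ i ∈ OddIcc, (rho n (c n) i : ℝ) * (V i : ℝ) * zetaValue i := by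
      simp_rw [mul_sum]
      rw [sum_comm]
      refine sum_congr rfl fun i _ => ?_
      rw [hV]
      push_cast
      simp only [mul_sum, sum_mul]
      exact sum_congr rfl fun d _ => by ring
    rw [h2, ← sum_sdiff hTO, add_comm]
    have h3 : ∑ i ∈ T, (rho n (c n) i : ℝ) * (V i : ℝ) * zetaValue i = 0 :=
      sum_eq_zero fun i hi => by rw [hVT i hi, Int.cast_zero, mul_zero, zero_mul]
    rw [h3, zero_add]
    refine sum_congr rfl fun i hi => ?_
    rw [hq i (mem_sdiff.1 hi).1 (mem_sdiff.1 hi).2]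
  -- Step 2: integrality of `A d_{n+1}^{s+1} rtilde n`
  have hint : ∀ n : ℕ, 1 ≤ n → ∃ z : ℤ,
      (A : ℝ) * (Nat.lcmUpto (n + 1) : ℝ) ^ (s + 1) * rtilde n = z := by
    intro n hn
    have hz0 : ∀ j' : ℕ, ∃ z : ℤ, 1 ≤ j' → j' ≤ D →
        (Nat.lcmUpto (n + 1) : ℚ) ^ (s + 1) * rhoZero s D n (c n) j' = z := by
      intro j'
      by_cases h : 1 ≤ j' ∧ j' ≤ D
      · obtain ⟨z, hz⟩ := lemma2_rhoZero_lcm (hc n hn) h3D hn j' h.1 h.2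
        exact ⟨z, fun _ _ => hz⟩
      · exact ⟨0, fun h1 h2 => absurd ⟨h1, h2⟩ h⟩
    choose z0 hz0 using hz0
    have hz1 : ∀ i : ℕ, ∃ z : ℤ, i ∈ OddIcc →
        (Nat.lcmUpto (n + 1) : ℚ) ^ (s + 1) * rho n (c n) i = z := by
      intro i
      by_cases hi : i ∈ OddIcc
      · have hi3 : 3 ≤ i ∧ i ≤ s := by
          have := mem_Icc.1 (mem_filter.1 hi).1; exact ⟨this.1, this.2⟩
        obtain ⟨z, hz⟩ := lemma2_rho (hc n hn) h3D hn hD (Nat.lcmUpto (n + 1))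
          (fun k h1 h2 => natCast_dvd_lcmUpto' h1 (by omega)) i (by omega) (by omega)
        refine ⟨(Nat.lcmUpto (n + 1) : ℤ) ^ i * z, fun _ => ?_⟩
        push_cast
        rw [← hz, ← mul_assoc, ← pow_add, show i + (s + 1 - i) = s + 1 by omega]
      · exact ⟨0, fun h => absurd h hi⟩
    choose z1 hz1 using hz1
    have hAq : ∀ i ∈ OddIcc \ T, ∃ z : ℤ, (A : ℚ) * q i = z := by
      intro i hi
      obtain ⟨k, hk⟩ : (q i).den ∣ A := dvd_prod_of_mem _ hi
      refine ⟨k * (q i).num, ?_⟩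
      rw [hk]
      push_cast
      rw [mul_comm ((q i).den : ℚ), mul_assoc, mul_comm ((q i).den : ℚ) (q i), Rat.mul_den_eq_num]
    choose! zq hzq using hAq
    refine ⟨(A : ℤ) * ∑ d ∈ D.divisors, w d * ∑ j ∈ range d, z0 ((j + 1) * (D / d)) +
      ∑ i ∈ OddIcc \ T, z1 i * V i * zq i, ?_⟩
    rw [hstruct n hn]
    have e1 : ∀ d ∈ D.divisors, ∀ j ∈ range d,
        (Nat.lcmUpto (n + 1) : ℝ) ^ (s + 1) * (rhoZero s D n (c n) ((j + 1) * (D / d)) : ℝ) =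
          (z0 ((j + 1) * (D / d)) : ℝ) := by
      intro d hd j hj
      obtain ⟨hj1, hj2⟩ := hjrange d hd j hj
      have := hz0 _ hj1 hj2
      exact_mod_cast congrArg (fun x : ℚ => (x : ℝ)) this
    have e2 : ∀ i ∈ OddIcc \ T,
        (A : ℝ) * (Nat.lcmUpto (n + 1) : ℝ) ^ (s + 1) * ((rho n (c n) i : ℝ) * (V i : ℝ) * (q i : ℝ)) =
          (z1 i : ℝ) * (V i : ℝ) * (zq i : ℝ) := by
      intro i hi
      have h1 := congrArg (fun x : ℚ => (x : ℝ)) (hz1 i (mem_sdiff.1 hi).1)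
      have h2 := congrArg (fun x : ℚ => (x : ℝ)) (hzq i hi)
      push_cast at h1 h2 ⊢
      rw [← h1, ← h2]
      ring
    have eP : (A : ℝ) * (Nat.lcmUpto (n + 1) : ℝ) ^ (s + 1) *
        (∑ d ∈ D.divisors, (w d : ℝ) * ∑ j ∈ range d, (rhoZero s D n (c n) ((j + 1) * (D / d)) : ℝ)) =
        (((A : ℤ) * ∑ d ∈ D.divisors, w d * ∑ j ∈ range d, z0 ((j + 1) * (D / d)) : ℤ) : ℝ) := by
      push_cast
      simp only [mul_sum]
      refine sum_congr rfl fun d hd => sum_congr rfl fun j hj => ?_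
      rw [← e1 d hd j hj]
      ring
    have eQ : (A : ℝ) * (Nat.lcmUpto (n + 1) : ℝ) ^ (s + 1) *
        (∑ i ∈ OddIcc \ T, (rho n (c n) i : ℝ) * (V i : ℝ) * (q i : ℝ)) =
        ((∑ i ∈ OddIcc \ T, z1 i * V i * zq i : ℤ) : ℝ) := by
      rw [mul_sum]
      push_cast
      exact sum_congr rfl fun i hi => e2 i hi
    rw [mul_add, eP, eQ]
    push_cast
    ring
  -- Step 3: asymptotics — `rtilde n = ∑_d w_d d S(d)` and `S(d)/S(D) → 1`
  have hSpos : ∀ n : ℕ, 0 < S 1 D s n D := fun n =>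
    Literature.NumberTheory.Transcendental.OddZetaSampling.S_pos hDpos le_rfl hs'
  have hrtS : ∀ n : ℕ, 1 ≤ n → rtilde n = ∑ d ∈ D.divisors, (w d : ℝ) * ((d : ℝ) * S 1 D s n d) := by
    intro n hn
    rw [hrtilde]
    exact sum_congr rfl fun d hd => by rw [sum_r_eq_mul_S hn hD h3D1 (Nat.dvd_of_mem_divisors hd)]
  -- the window parameter `K` of the tree's ratio theorem: `1 + 2(s+1) ≤ D log(K/6)`
  set K : ℕ := ⌈6 * Real.exp ((2 * (s : ℝ) + 3) / D)⌉₊ with hK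
  have hD0 : (0 : ℝ) < D := by exact_mod_cast hDpos
  have hK0 : 0 < K := by
    rw [hK]
    exact Nat.lt_ceil.2 (by have := Real.exp_pos ((2 * (s : ℝ) + 3) / D); push_cast; linarith)
  have hwin : 1 + 2 * ((s : ℝ) + 1) / (1 : ℕ) ≤ D * Real.log (((1 : ℕ) : ℝ) * K / 6) := by
    have hK6 : Real.exp ((2 * (s : ℝ) + 3) / D) ≤ ((1 : ℕ) : ℝ) * K / 6 := by
      rw [Nat.cast_one, one_mul, le_div_iff₀ (by norm_num : (0 : ℝ) < 6), mul_comm, hK]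
      exact Nat.le_ceil _
    have hlog : (2 * (s : ℝ) + 3) / D ≤ Real.log (((1 : ℕ) : ℝ) * K / 6) := by
      rw [← Real.exp_le_exp, Real.exp_log (lt_of_lt_of_le (Real.exp_pos _) hK6)]
      exact hK6
    have := mul_le_mul_of_nonneg_left hlog hD0.le
    rw [mul_div_cancel₀ _ hD0.ne'] at this
    push_cast
    linarith
  have hratio_d : ∀ d ∈ D.divisors, Tendsto (fun n : ℕ => S 1 D s n d / S 1 D s n D) atTop (𝓝 1) := by
    intro d hd
    rw [Metric.tendsto_nhds]
    intro θ hθ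
    have hev := Literature.NumberTheory.Transcendental.OddZetaSampling.eventually_abs_S_sub_S_le
      (r := 1) (s := s) hDpos le_rfl hs' hK0 hwin (half_pos hθ)
    filter_upwards [hev] with n hn
    have h := hn d D (Nat.dvd_of_mem_divisors hd) (dvd_refl D)
    have hS := hSpos n
    have hθS := mul_pos hθ hS
    rw [Real.dist_eq, div_sub_one hS.ne', abs_div, abs_of_pos hS, div_lt_iff₀ hS]
    linarith
  have hratio : Tendsto (fun n : ℕ => rtilde n / S 1 D s n D) atTop (𝓝 (N : ℝ)) := by
    have hform : ∀ᶠ n : ℕ in atTop, ∑ d ∈ D.divisors, (w d : ℝ) * ((d : ℝ) * (S 1 D s n d / S 1 D s n D)) =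
        rtilde n / S 1 D s n D := by
      filter_upwards [eventually_ge_atTop 1] with n hn
      rw [hrtS n hn, sum_div]
      refine sum_congr rfl fun d _ => ?_
      rw [mul_div_assoc, mul_div_assoc]
    refine Tendsto.congr' hform ?_
    rw [hN]
    push_cast
    refine tendsto_finsetSum _ fun d hd => ?_
    have := ((hratio_d d hd).const_mul (d : ℝ)).const_mul (w d : ℝ)
    rwa [mul_one] at this
  have hTn : Tendsto (fun n : ℕ => (Nat.lcmUpto (n + 1) : ℝ) ^ (s + 1) * S 1 D s n D) atTop (𝓝 0) :=
    hdecay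
  have hzlim : Tendsto (fun n : ℕ => (A : ℝ) * (Nat.lcmUpto (n + 1) : ℝ) ^ (s + 1) * rtilde n)
      atTop (𝓝 0) := by
    have h := (hTn.const_mul (A : ℝ)).mul hratio
    rw [mul_zero, zero_mul] at h
    refine h.congr' ?_
    filter_upwards [eventually_ge_atTop 1] with n hn
    have := (hSpos n).ne'
    field_simp
  have hne : ∀ᶠ n : ℕ in atTop, (A : ℝ) * (Nat.lcmUpto (n + 1) : ℝ) ^ (s + 1) * rtilde n ≠ 0 := by
    have hN0 : (N : ℝ) ≠ 0 := by exact_mod_cast hwN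
    have h1 : ∀ᶠ n : ℕ in atTop, rtilde n / S 1 D s n D ≠ 0 :=
      hratio.eventually (isOpen_ne.mem_nhds hN0)
    filter_upwards [h1, eventually_ge_atTop 1] with n hn hn1
    have hA0 : (A : ℝ) ≠ 0 := by exact_mod_cast hApos.ne'
    have hd0 : (Nat.lcmUpto (n + 1) : ℝ) ^ (s + 1) ≠ 0 :=
      pow_ne_zero _ (by exact_mod_cast (Nat.lcmUpto_pos _).ne')
    have hrt : rtilde n ≠ 0 := fun h0 => hn (by rw [h0, zero_div])
    exact mul_ne_zero (mul_ne_zero hA0 hd0) hrt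
  -- Step 4: a non-zero integer of absolute value `< 1`
  have hsmall : ∀ᶠ n : ℕ in atTop, |(A : ℝ) * (Nat.lcmUpto (n + 1) : ℝ) ^ (s + 1) * rtilde n| < 1 := by
    have := (hzlim.abs).eventually (gt_mem_nhds (show |(0 : ℝ)| < 1 by simp))
    exact this
  obtain ⟨n, hn1, hn2, hn3⟩ := ((eventually_ge_atTop 1).and (hne.and hsmall)).exists
  obtain ⟨z, hz⟩ := hint n hn1
  rw [hz] at hn2 hn3
  have hz0 : z = 0 := by
    have : |z| < 1 := by exact_mod_cast hn3
    exact Int.abs_lt_one_iff.1 this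
  exact hn2 (by rw [hz0, Int.cast_zero])

/-! ### The choice of `D` and the prime number theorem (as in `EliminationProof.lean`) -/

/-- `2 ∣ ∏_{p ≤ N} p` for `N ≥ 2`. [folklore] -/
private theorem two_dvd_primorial' {N : ℕ} (hN : 2 ≤ N) : 2 ∣ primorial N := by
  rw [primorial_eq_prod_primesLE]
  exact dvd_prod_of_mem _ (Nat.mem_primesLE.2 ⟨hN, Nat.prime_two⟩)

/-- There are at least `(s-1)/2` odd integers in `[3, s]`. [folklore] -/
private theorem half_le_card_oddIcc' (s : ℕ) : (s - 1) / 2 ≤ #((Icc 3 s).filter Odd) := by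
  classical
  have hsub : (Icc 1 ((s - 1) / 2)).image (fun k => 2 * k + 1) ⊆ (Icc 3 s).filter Odd := by
    intro x hx
    obtain ⟨k, hk, rfl⟩ := mem_image.1 hx
    have hk' := mem_Icc.1 hk
    refine mem_filter.2 ⟨mem_Icc.2 ⟨by omega, by omega⟩, odd_two_mul_add_one k⟩
  calc (s - 1) / 2 = #(Icc 1 ((s - 1) / 2)) := by simp
    _ = #((Icc 1 ((s - 1) / 2)).image (fun k => 2 * k + 1)) :=
        (card_image_of_injective _ fun a b hab => by simpa using hab).symm
    _ ≤ _ := card_le_card hsub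

/-- PNT, `θ`-form: `log ∏_{p ≤ N} p = θ(N) ≤ (1+η) N` for all large `N`
(tree: `chebyshevTheta_sub_self_isLittleO`). [folklore] -/
private theorem eventually_log_primorial_le' {η : ℝ} (hη : 0 < η) :
    ∃ N₁ : ℕ, ∀ N : ℕ, N₁ ≤ N → Real.log (primorial N) ≤ (1 + η) * N := by
  have h := (Literature.NumberTheory.LFunctions.chebyshevTheta_sub_self_isLittleO.def hη)
  obtain ⟨N₁, hN₁⟩ := eventually_atTop.1 h
  refine ⟨N₁, fun N hN => ?_⟩
  have h1 := hN₁ N hN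
  rw [Real.norm_eq_abs, Real.norm_eq_abs, abs_of_nonneg (show (0 : ℝ) ≤ (N : ℝ) from Nat.cast_nonneg N)] at h1
  have h2 : Chebyshev.theta N = Real.log (primorial N) := by
    rw [Chebyshev.theta_eq_log_primorial, Nat.floor_natCast]
  rw [← h2]
  linarith [le_abs_self (Chebyshev.theta N - N)]

/-- PNT for `π`: `π(x) ≥ (1-η) x/log x` for all large real `x`
(tree: `primeCounting_isEquivalent_holds`). [folklore] -/
private theorem eventually_primeCounting_ge' {η : ℝ} (hη : 0 < η) :
    ∃ x₀ : ℝ, ∀ x : ℝ, x₀ ≤ x → (1 - η) * (x / Real.log x) ≤ Nat.primeCounting ⌊x⌋₊ := by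
  have h := Literature.NumberTheory.LFunctions.primeCounting_isEquivalent_holds
  have hb := (h.isLittleO.def hη)
  obtain ⟨x₀, hx₀⟩ := eventually_atTop.1 (hb.and (eventually_gt_atTop 1))
  refine ⟨x₀, fun x hx => ?_⟩
  obtain ⟨h1, hx1⟩ := hx₀ x hx
  have hpos : 0 < x / Real.log x := div_pos (by linarith) (Real.log_pos hx1)
  simp only [Pi.sub_apply, Real.norm_eq_abs] at h1
  rw [abs_of_pos hpos] at h1
  have := neg_abs_le ((Nat.primeCounting ⌊x⌋₊ : ℝ) - x / Real.log x)
  linarith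


/-! ### Theorem 2, unconditionally -/

/-- **Fischler–Sprang–Zudilin 2019, Theorem 2** (PROVED): for every `ε > 0` and every sufficiently large odd
`s`, at least `2^{(1-ε) log s/log log s}` of the numbers `ζ(3), ζ(5), …, ζ(s)` are irrational — the tree's
named fact `manyOddZetaValuesIrrational` is hereby discharged. The proof is that of §6 of the source
(`D = ∏_{p ≤ (1-2ε') log s} p` with `ε' = min(ε,1/4)/3`; `log D ≤ (1-ε') log s` and
`#{d ∣ D} = 2^{π((1-2ε') log s)} ≥ 2^{(1-ε) log s/log log s}` by the prime number theorem; Lemmas 1, 2, 4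
PROVED in `LinearForms.lean` / `GeneralizedVandermonde.lean`; the elimination
`card_divisors_le_card_irrational_of_decay`), with ONE deviation: instead of the sharp asymptotics of
Lemma 3 (`lim r_{n,j}^{1/n} = g(x₀)`, `lim r_{n,j'}/r_{n,j} = 1`, kept as the named fact `lemma3`) we use
(a) the lattice-sum ratios `S(d)/S(D) → 1` of the tree's `OddZetaSampling` (Sprang's route) and (b) the crude
bound `r_{n,j} ≤ poly(n)·((8eD)^{3D} 4^{-(s+1)})^n` (`r_le_crude`), which with `d_{n+1} ≤ e^{1.1(n+1)}` still
gives `d_{n+1}^{s+1} S(D) → 0` as soon as `12·D(log D + 4) ≤ s` — true for the source's `D ≤ s^{1-ε'}`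
and `s` large. The count `2^{(1-ε) log s/log log s}` is exactly the printed one.
[cite: FischlerSprangZudilin2019, §1 Theorem 2; §6 (proof of Theorem 2)] -/
theorem manyOddZetaValuesIrrational_holds : manyOddZetaValuesIrrational := by
  classical
  -- reduction to small `ε`
  suffices hmain : ∀ ε : ℝ, 0 < ε → ε ≤ 1 / 4 → ∃ s₀ : ℕ, ∀ s : ℕ, s₀ ≤ s → Odd s →
      (2 : ℝ) ^ ((1 - ε) * Real.log s / Real.log (Real.log s)) ≤
        (({i : ℕ | Odd i ∧ 3 ≤ i ∧ i ≤ s ∧ Irrational (zetaValue i)}).ncard : ℝ) by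
    intro ε hε
    obtain ⟨s₀, hs₀⟩ := hmain (min ε (1 / 4)) (lt_min hε (by norm_num)) (min_le_right _ _)
    refine ⟨max s₀ 3, fun s hs hodd => (hs₀ s (le_of_max_le_left hs) hodd).trans' ?_⟩
    have hs3 : (3 : ℝ) ≤ s := by exact_mod_cast le_of_max_le_right hs
    have hL : 0 ≤ Real.log s / Real.log (Real.log s) := by
      have h1 : 1 < Real.log s := by
        rw [← Real.exp_lt_exp, Real.exp_log (by linarith)]
        have := Real.exp_one_lt_d9; linarith
      exact div_nonneg (by linarith) (Real.log_pos h1).le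
    rw [mul_div_assoc, mul_div_assoc]
    exact Real.rpow_le_rpow_of_exponent_le (by norm_num)
      (mul_le_mul_of_nonneg_right (by linarith [min_le_left ε (1 / 4)]) hL)
  intro ε hε hε4
  -- parameters
  set η : ℝ := ε / 3 with hη
  have hη0 : 0 < η := by rw [hη]; linarith
  have hη1 : η ≤ 1 / 12 := by rw [hη]; linarith
  obtain ⟨N₁, hN₁⟩ := eventually_log_primorial_le' hη0
  obtain ⟨x₀, hx₀⟩ := eventually_primeCounting_ge' hη0
  -- `y(s) = (1-2η) log s → ∞`, `s^η → ∞`, `log s = o(s^η)`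
  set y : ℕ → ℝ := fun s => (1 - 2 * η) * Real.log s with hy
  have hy_tendsto : Tendsto y atTop atTop :=
    (Real.tendsto_log_atTop.comp tendsto_natCast_atTop_atTop).const_mul_atTop (by linarith)
  have hpow_tendsto : Tendsto (fun s : ℕ => (s : ℝ) ^ η) atTop atTop :=
    (tendsto_rpow_atTop hη0).comp tendsto_natCast_atTop_atTop
  have hlog_small : ∀ᶠ s : ℕ in atTop, 12 * (Real.log s + 4) ≤ (s : ℝ) ^ η := by
    have h := ((isLittleO_log_rpow_atTop hη0).comp_tendsto tendsto_natCast_atTop_atTop).def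
      (show (0 : ℝ) < 1 / 24 by norm_num)
    filter_upwards [h, eventually_ge_atTop 1, hpow_tendsto.eventually_ge_atTop 96] with s hs hs1 hs96
    simp only [Function.comp_apply, Real.norm_eq_abs] at hs
    rw [abs_of_nonneg (Real.log_nonneg (by exact_mod_cast hs1)),
      abs_of_nonneg (Real.rpow_nonneg (Nat.cast_nonneg s) η)] at hs
    linarith
  have hev : ∀ᶠ s : ℕ in atTop, ((N₁ : ℝ) + 1 ≤ y s ∧ x₀ ≤ y s ∧ 2 ≤ y s) ∧
      (4 ≤ (s : ℝ) ^ η ∧ 12 * (Real.log s + 4) ≤ (s : ℝ) ^ η) ∧ 3 ≤ s := by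
    filter_upwards [hy_tendsto.eventually_ge_atTop ((N₁ : ℝ) + 1), hy_tendsto.eventually_ge_atTop x₀,
      hy_tendsto.eventually_ge_atTop 2, hpow_tendsto.eventually_ge_atTop 4, hlog_small,
      eventually_ge_atTop 3] with s h1 h2 h3 h4 h5 h6
    exact ⟨⟨h1, h2, h3⟩, ⟨h4, h5⟩, h6⟩
  obtain ⟨s₀, hs₀⟩ := eventually_atTop.1 hev
  refine ⟨s₀, fun s hs hsodd => ?_⟩
  obtain ⟨⟨hyN₁, hyx₀, hy2⟩, ⟨hpow4, hlogC⟩, hs3⟩ := hs₀ s hs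
  -- the integer `N = ⌊y⌋` and `D = primorial N`
  set N : ℕ := ⌊y s⌋₊ with hNdef
  set D : ℕ := primorial N with hDdef
  have hs0 : (0 : ℝ) < s := by exact_mod_cast (by omega : 0 < s)
  have hlogs : 1 < Real.log s := by
    rw [← Real.exp_lt_exp, Real.exp_log hs0]
    have := Real.exp_one_lt_d9
    have : (3 : ℝ) ≤ s := by exact_mod_cast hs3
    linarith
  have hy0 : 0 ≤ y s := by linarith
  have hNy : (N : ℝ) ≤ y s := Nat.floor_le hy0
  have hN2 : 2 ≤ N := by
    rw [hNdef]; exact Nat.le_floor (by exact_mod_cast hy2)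
  have hNN₁ : N₁ ≤ N := by
    rw [hNdef]; refine Nat.le_floor ?_; linarith
  have hD1 : 1 ≤ D := primorial_pos N
  have hD2 : 2 ≤ D := Nat.le_of_dvd (primorial_pos N) (two_dvd_primorial' hN2)
  have hDeven : 2 ∣ D := two_dvd_primorial' hN2
  -- `log D ≤ (1-η) log s`, hence `D ≤ s / s^η`
  have hlogD : Real.log D ≤ (1 - η) * Real.log s := by
    calc Real.log D ≤ (1 + η) * N := hN₁ N hNN₁
      _ ≤ (1 + η) * y s := mul_le_mul_of_nonneg_left hNy (by linarith)
      _ = (1 + η) * (1 - 2 * η) * Real.log s := by rw [hy]; ring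
      _ ≤ (1 - η) * Real.log s := by
          apply mul_le_mul_of_nonneg_right _ (by linarith)
          nlinarith
  have hspow : (s : ℝ) = (s : ℝ) ^ (1 - η) * (s : ℝ) ^ η := by
    rw [← Real.rpow_add hs0, sub_add_cancel, Real.rpow_one]
  have hDle : (D : ℝ) ≤ (s : ℝ) ^ (1 - η) := by
    have hD0 : (0 : ℝ) < D := by exact_mod_cast hD1
    rw [← Real.log_le_log_iff hD0 (Real.rpow_pos_of_pos hs0 _), Real.log_rpow hs0]
    exact hlogD
  have hpow0 : 0 < (s : ℝ) ^ η := Real.rpow_pos_of_pos hs0 _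
  have h4D : 4 * D ≤ s := by
    have : 4 * (D : ℝ) ≤ s := by
      calc 4 * (D : ℝ) ≤ (s : ℝ) ^ η * (s : ℝ) ^ (1 - η) := by gcongr
        _ = s := by rw [mul_comm, ← hspow]
    exact_mod_cast this
  have h3D : 3 * D ≤ s := by omega
  have h3D1 : 3 * D + 1 ≤ s := by omega
  have hbig : 12 * ((D : ℝ) * (Real.log D + 4)) ≤ s := by
    have hD0 : (1 : ℝ) ≤ D := by exact_mod_cast hD1
    have hlogD0 : 0 ≤ Real.log D := Real.log_nonneg hD0
    have hlogD' : Real.log D + 4 ≤ Real.log s + 4 := by nlinarith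
    calc 12 * ((D : ℝ) * (Real.log D + 4)) ≤ 12 * ((s : ℝ) ^ (1 - η) * (Real.log s + 4)) := by
          gcongr
      _ = (s : ℝ) ^ (1 - η) * (12 * (Real.log s + 4)) := by ring
      _ ≤ (s : ℝ) ^ (1 - η) * (s : ℝ) ^ η := mul_le_mul_of_nonneg_left hlogC (by positivity)
      _ = s := hspow.symm
  -- room for the exponents
  have hroom : #D.divisors ≤ #((Icc 3 s).filter Odd) + 1 := by
    have h1 := Nat.card_divisors_le_self D
    have h2 := half_le_card_oddIcc' s
    omega
  -- the decay of the cleared forms for `(s, D)` and the elimination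
  have hdecay := tendsto_lcm_pow_mul_S hD2 h3D1 hbig
  have hcore := card_divisors_le_card_irrational_of_decay hsodd h3D hD1 hDeven hdecay hroom
  -- counting: `2^{(1-ε) log s/log log s} ≤ 2^{π(N)} = #{d ∣ D}`
  rw [hDdef, card_divisors_primorial] at hcore
  have hπ : (1 - ε) * Real.log s / Real.log (Real.log s) ≤ Nat.primeCounting N := by
    have hlls : 0 < Real.log (Real.log s) := Real.log_pos hlogs
    have hy1 : 1 < y s := by linarith
    have hlogy : 0 < Real.log (y s) := Real.log_pos hy1
    have hlogy' : Real.log (y s) ≤ Real.log (Real.log s) := by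
      rw [Real.log_le_log_iff (by linarith) (by linarith), hy]
      nlinarith
    have hpnt := hx₀ (y s) hyx₀
    rw [← hNdef] at hpnt
    calc (1 - ε) * Real.log s / Real.log (Real.log s)
        ≤ (1 - η) * (1 - 2 * η) * Real.log s / Real.log (Real.log s) := by
          apply div_le_div_of_nonneg_right _ hlls.le
          apply mul_le_mul_of_nonneg_right _ (by linarith)
          rw [hη]; nlinarith
      _ = (1 - η) * (y s / Real.log (Real.log s)) := by rw [hy]; ring
      _ ≤ (1 - η) * (y s / Real.log (y s)) := by
          apply mul_le_mul_of_nonneg_left _ (by linarith)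
          exact div_le_div_of_nonneg_left (by linarith) hlogy hlogy'
      _ ≤ Nat.primeCounting N := hpnt
  calc (2 : ℝ) ^ ((1 - ε) * Real.log s / Real.log (Real.log s))
      ≤ (2 : ℝ) ^ ((Nat.primeCounting N : ℕ) : ℝ) := Real.rpow_le_rpow_of_exponent_le (by norm_num) hπ
    _ = ((2 ^ Nat.primeCounting N : ℕ) : ℝ) := by rw [Real.rpow_natCast]; push_cast; rfl
    _ ≤ _ := by exact_mod_cast hcore


end Literature.NumberTheory.Irrationality.FischlerSprangZudilin2019
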